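import Summits.BirchSwinnertonDyer.BirchSwinnertonDyer.Theorems.SignedLowerHalvesSmallImageLowerHalfBothSignsRttJunctionShaIota
import Summits.BirchSwinnertonDyer.BirchSwinnertonDyer.Theorems.SignedLowerHalvesSmallImageLowerHalfBothSignsRttJunctionLambdaStrictDual
import Summits.BirchSwinnertonDyer.BirchSwinnertonDyer.Theorems.SignedLowerHalvesSmallImageLowerHalfBothSignsRttD2SeqJ3HControl
import Summits.BirchSwinnertonDyer.BirchSwinnertonDyer.Theorems.SignedLowerHalvesSmallImageLowerHalfBothSignsRttCharRoadE1TowerLayers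
import HarnessLib

/-!
# Route `SignedLowerHalves`, crux L `SmallImageLowerHalfBothSigns` (stmt-BirchSwinnertonDyer-23599), line `rtt_w3` v35 — stub S3α″ (`stub_junctionShaPi_ns`),
# brick α5′-3b: THE COMPARISON MAPS LAND IN THE STRICT SELMER GROUP — `ι_{n,k} : Ш¹_P(K_n, A[p^k]) → Sel_{str at Σ}(K_∞, A)` (`Σ ⊆ P`) and their laws

INPUTS hand `bsd-inputs-honda-p1` g29 under LEAD `cruxlead-stmt-BirchSwinnertonDyer-23599` (cell `bsd-ssimc`); helper `--supports stmt-BirchSwinnertonDyer-23599`.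
DEFINITIONS WITH BODIES (`iotaSat`, `iotaSel`) + THEOREMS; no named fact, no instance, no `sorry`. For an abstract discrete `Γ_K`-module `A = M` with open stabilisers,
scalars `R`, a Weierstrass model `V/K` with transport `j`, sign `ε`, bad set `S₀` and `P ⊇ {v ∣ p}` (`hpP`):
* §1 `iotaLayerO_mem_unramifiedOutside` — the layer class `ι^{layer}_{n,k} z ∈ H¹(U_n, A)` of `z ∈ Ш¹_P(K_n, A[p^k])` is UNRAMIFIED EVERYWHERE, all conjugates (inertia
  dies in `G_P` off `P`; local triviality on `P`; the tree's `toSubgroupH1_mem_unramifiedKer(_of_not_mem)`); `locH1Layer_iotaLayerO_eq_zero` — its layer localisation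
  `loc_{v,n}` (-w3) VANISHES at every `v ∈ P` (the coboundary witness of `ShaLayer.exists_of_localization_eq_zero`, read through `res_{K_v} = resGalOfEmb (closureEmb K_v)`);
  hence `iotaLayerO_mem_signedTransportSelmerLayerSat` (lambda-p1's saturated signed layer Selmer group: a local coboundary is the restriction of a global one, -w3's
  `mem_localKummerTransportSat_of_locH1Layer_mem`), `iotaO_mem_signedTransportSelmerInftySat` (`Sel(K_∞) = ⋃ res Sel(K_n)`), `locAt_iotaO_eq_zero`;
* §2 ★ `iotaSel n k : Ш¹_P(K_n, A[p^k]) →+ strictSelmer κ M R V j S₀ ε Σ` for `Σ ⊆ P` (`iotaO` corestricted), with the socket's laws `iotaSel_resYO`, `iotaSel_inclYO`,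
  `iotaSel_conjYO` (`ι (conj_δ z) = conjStrict δ (ι z)`), and `iotaSel_eq_zero_iff` (`ι^{Sel} z = 0 ↔ ι z = 0`, for the kernel property).
HONEST FRAMING: cohomological bookkeeping; α5′, S3α″, crux L and BSD are NOT proved here and remain OPEN; BSD is proved for NO curve.
References: [Kobayashi2003] Def. 1.1, Thm. 7.3 i); [GreenbergVatsal2000] §2 pp. 16–17; [SerreGaloisCohomology1997] I §2.4–2.5, I §5.1, II §1.1; [MilneADT2006] I §4 (p. 56);
[JohnsonLeungKings2011] §5.4 Lemma 5.8 (arXiv p0015:L150–165).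
-/

set_option autoImplicit false
set_option linter.dupNamespace false -- D-0017: single-problem summit, the namespace repeats the problem name by design
noncomputable section

open scoped Classical
open NumberField IsDedekindDomain Field Function CategoryTheory

namespace Summit.BirchSwinnertonDyer.BirchSwinnertonDyer.Theorems.SmallImageRttJunctionSha

open Literature.NumberTheory.EllipticCurves Literature.NumberTheory.EllipticCurves.GreenbergVatsal2000 Literature.NumberTheory.EllipticCurves.Kobayashi2003
  Literature.NumberTheory.GaloisRepresentations Literature.NumberTheory.GaloisRepresentations.DiscreteGaloisModule Literature.NumberTheory.GaloisCohomology
  Literature.NumberTheory.GaloisCohomology.ShaLayer Summit.BirchSwinnertonDyer.BirchSwinnertonDyer.Theorems.SmallImageRttD2Seq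
  Summit.BirchSwinnertonDyer.BirchSwinnertonDyer.Theorems.SmallImageCharSignedSelmer

/-! ## §1 Local conditions of the layer classes -/

section Local

variable {K : Type} [Field K] [NumberField K] {p : ℕ} [Fact p.Prime] (κ : ZpExtension K p) (P : Set (HeightOneSpectrum (𝓞 K)))
  (M : Type) [AddCommGroup M] [DistribMulAction (absoluteGaloisGroup K) M] [TopologicalSpace M] [DiscreteTopology M]
  (hstab : ∀ m : M, IsOpen (MulAction.stabilizer (absoluteGaloisGroup K) m : Set (absoluteGaloisGroup K)))

/-- The localisation of a `Ш¹`-class at a place `v ∈ P` vanishes (the `σ = 1` instance of the membership). [cite: MilneADT2006, I §4 (p. 56)] -/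
theorem localization_eq_zero_of_mem {v : HeightOneSpectrum (𝓞 K)} (hv : v ∈ P) (n k : ℕ) (z : ↥(layerShaRestricted P (torsRep M hstab p k) (κ.layerSubgroup n) 1)) :
    (ContinuousCohomology.map (comapSubtypeHom ((κ.layerSubgroup n).map (toUnramifiedQuot K P)) (locHom (S := P) v))
        (comapCoeffHom (DiscreteGaloisModule.quotientInvariants (torsRep M hstab p k) (ramificationSubgroup K P)).toTopRep ((κ.layerSubgroup n).map (toUnramifiedQuot K P))
          (locHom (S := P) v)) 1).hom z.1 = 0 := by
  have hz := z.2
  rw [mem_layerShaRestricted_iff] at hz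
  have h := hz.2 v hv (toUnramifiedQuot K P 1)
  rw [layerConj_eq_self_of_mem P (torsRep M hstab p k) (Subgroup.mem_map_of_mem _ (one_mem _)), layerLocalization_inr_eq] at h
  exact h

/-- ★ **The layer class `ι^{layer}_{n,k} z ∈ H¹(U_n, A)` of a `Ш¹`-class is UNRAMIFIED EVERYWHERE** (all conjugates; in particular it lies in Greenberg–Vatsal's
`unramifiedOutside U_n A p S₀` for every `S₀`): off `P` the inertia dies in `G_P`, on `P` the class is locally trivial. [cite: GreenbergVatsal2000, §2 pp. 16–17] [cite: MilneADT2006, I §4 (p. 56)] -/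
theorem iotaLayerO_mem_unramifiedOutside (S₀ : Set (HeightOneSpectrum (𝓞 K))) (n k : ℕ) (z : ↥(layerShaRestricted P (torsRep M hstab p k) (κ.layerSubgroup n) 1)) :
    iotaLayerO κ P M hstab n k z ∈ unramifiedOutside (κ.layerSubgroup n) M p S₀ := by
  refine (mem_unramifiedOutside_iff _).2 fun v _ _ σ ↦ ?_
  rw [← iotaLayerO_conjYO, iotaLayerO_apply]
  by_cases hvP : v ∈ P
  · exact toSubgroupH1_mem_unramifiedKer (le_refl _) _ (localization_eq_zero_of_mem κ P M hstab hvP n k _)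
  · exact toSubgroupH1_mem_unramifiedKer_of_not_mem (le_refl _) hvP _

/-- ★ **The layer localisation `loc_{v,n} (ι^{layer}_{n,k} z)` (-w3's `locH1Layer`, canonical local action) VANISHES at every `v ∈ P`**: on cocycles, the pulled-back cocycle on
`res_ι⁻¹(U_n) ≤ Γ_{K_v}` is the coboundary of the witness `m ∈ A[p^k]` of `ShaLayer.exists_of_localization_eq_zero` (`res_ι = resGalOfEmb (closureEmb K_v) = absGaloisRestrict`,
definitionally). [cite: SerreGaloisCohomology1997, I §5.1, II §1.1] [cite: MilneADT2006, I §4 (p. 56)] -/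
theorem locH1Layer_iotaLayerO_eq_zero {v : HeightOneSpectrum (𝓞 K)} (hv : v ∈ P) (n k : ℕ) (z : ↥(layerShaRestricted P (torsRep M hstab p k) (κ.layerSubgroup n) 1)) :
    letI := localAction (closureEmb (K := K) (v.adicCompletion K)) M
    locH1Layer κ M v (fun _ _ ↦ rfl) n (iotaLayerO κ P M hstab n k z) = 0 := by
  letI := localAction (closureEmb (K := K) (v.adicCompletion K)) M
  obtain ⟨c, hc⟩ := oneCocycleClass_surjective _ z.1
  have hloc := localization_eq_zero_of_mem κ P M hstab hv n k z
  rw [← hc] at hloc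
  obtain ⟨m, hm⟩ := exists_of_localization_eq_zero v c hloc
  rw [iotaLayerO_apply, ← hc, ShaLayer.toSubgroupH1_oneCocycleClass, locH1Layer, resH1Hom_oneCocycleClass, oneCocycleClass_eq_zero_iff]
  refine ⟨((m : ↥(torsionPow M p k)) : M), fun τ ↦ ?_⟩
  have hτ : (τ : absoluteGaloisGroup (v.adicCompletion K)) ∈ ((κ.layerSubgroup n).map (toUnramifiedQuot K P)).comap
      (locHom (S := P) v : absoluteGaloisGroup (v.adicCompletion K) →* GaloisGroupUnramifiedOutside K P) := by
    rw [Subgroup.mem_comap]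
    exact Subgroup.mem_map_of_mem _ τ.2
  have hel : toLayerGroup P (le_refl (κ.layerSubgroup n)) (resGalSubgroupOfEmb (κ.layerSubgroup n) (closureEmb (K := K) (v.adicCompletion K)) τ) =
      comapSubtypeHom _ (locHom (S := P) v) ⟨τ, hτ⟩ := Subtype.ext rfl
  rw [pullback_resHomOfEquivariant_apply, pullback_toLayerGroup_apply, hel, hm ⟨τ, hτ⟩, discreteTopRep_ρ_apply]
  rfl

variable (R : Type*) [Ring R] [Module R M] (V : WeierstrassCurve K) (j : V.geomPrimaryTorsion p →+ M) (S₀ : Set (HeightOneSpectrum (𝓞 K))) (ε : ℤˣ)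
  (hpP : ∀ v : HeightOneSpectrum (𝓞 K), ((p : ℕ) : 𝓞 K) ∈ v.asIdeal → v ∈ P)

include hpP in
/-- ★ **`ι^{layer}_{n,k} z ∈ Sel^{ε,S₀}_R(K_n, A)`** (lambda-p1's saturated signed layer Selmer group): unramified everywhere, and at `v ∣ p` (`⊆ P`) every conjugate satisfies the saturated
transported condition because its layer localisation vanishes (-w3's `mem_localKummerTransportSat_of_locH1Layer_mem`: a local coboundary is the restriction of a global one).
[cite: Kobayashi2003, Def. 1.1] [cite: GreenbergVatsal2000, §2 pp. 16–17] -/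
theorem iotaLayerO_mem_signedTransportSelmerLayerSat (n k : ℕ) (z : ↥(layerShaRestricted P (torsRep M hstab p k) (κ.layerSubgroup n) 1)) :
    iotaLayerO κ P M hstab n k z ∈ signedTransportSelmerLayerSat κ M R V j S₀ ε n := by
  rw [mem_signedTransportSelmerLayerSat_iff]
  refine ⟨iotaLayerO_mem_unramifiedOutside κ P M hstab S₀ n k z, fun v hvp σ ↦ ?_⟩
  letI := localAction (closureEmb (K := K) (v.adicCompletion K)) M
  rw [← iotaLayerO_conjYO]
  exact mem_localKummerTransportSat_of_locH1Layer_mem (κ := κ) (M := M) (R := R) (v := v) (hres := fun _ _ ↦ rfl) V j ε hstab n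
    (by rw [locH1Layer_iotaLayerO_eq_zero κ P M hstab (hpP v hvp)]; exact zero_mem _)

include hpP in
/-- ★ **`ι_{n,k} z ∈ Sel^{ε,S₀}_R(K_∞, A) = ⋃_n res Sel^{ε,S₀}_R(K_n, A)`** (the layer class is a witness, `resOfLe_iotaLayerO`). [cite: Kobayashi2003, Def. 1.1] -/
theorem iotaO_mem_signedTransportSelmerInftySat (n k : ℕ) (z : ↥(layerShaRestricted P (torsRep M hstab p k) (κ.layerSubgroup n) 1)) :
    iotaO κ P M hstab n k z ∈ signedTransportSelmerInftySat κ M R V j S₀ ε :=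
  (mem_signedTransportSelmerInftySat_iff κ M R V j S₀ ε _).2
    ⟨n, iotaLayerO κ P M hstab n k z, iotaLayerO_mem_signedTransportSelmerLayerSat κ P M hstab R V j S₀ ε hpP n k z, resOfLe_iotaLayerO κ P M hstab n k z⟩

/-- **`loc_w (ι_{n,k} z) = 0` for `w ∈ P`** (lambda-p1's `locAt`; `loc_w ∘ res_{n→∞} = res ∘ loc_{w,n}` and `loc_{w,n}` kills the layer class). [cite: Kobayashi2003, Thm. 7.3 i)]
[cite: SerreGaloisCohomology1997, I §2.5] -/
theorem locAt_iotaO_eq_zero {w : HeightOneSpectrum (𝓞 K)} (hw : w ∈ P) (n k : ℕ) (z : ↥(layerShaRestricted P (torsRep M hstab p k) (κ.layerSubgroup n) 1)) :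
    locAt κ M w (iotaO κ P M hstab n k z) = 0 := by
  letI := localAction (closureEmb (K := K) (w.adicCompletion K)) M
  change locH1 κ M w (fun _ _ ↦ rfl) (iotaO κ P M hstab n k z) = 0
  rw [← resOfLe_iotaLayerO, ← AddMonoidHom.comp_apply, ← resOfLe_comp_locH1Layer, AddMonoidHom.comp_apply, locH1Layer_iotaLayerO_eq_zero κ P M hstab hw, map_zero]

end Local

/-! ## §2 The comparison maps into the strict Selmer group -/

section Sel

variable {K : Type} [Field K] [NumberField K] {p : ℕ} [Fact p.Prime] (κ : ZpExtension K p) (P : Set (HeightOneSpectrum (𝓞 K)))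
  (M : Type) [AddCommGroup M] [DistribMulAction (absoluteGaloisGroup K) M] [TopologicalSpace M] [DiscreteTopology M]
  (hstab : ∀ m : M, IsOpen (MulAction.stabilizer (absoluteGaloisGroup K) m : Set (absoluteGaloisGroup K)))
  (R : Type*) [Ring R] [Module R M] (V : WeierstrassCurve K) (j : V.geomPrimaryTorsion p →+ M) (S₀ : Set (HeightOneSpectrum (𝓞 K))) (ε : ℤˣ)
  (S₁ : Set (HeightOneSpectrum (𝓞 K)))
  (hpP : ∀ v : HeightOneSpectrum (𝓞 K), ((p : ℕ) : 𝓞 K) ∈ v.asIdeal → v ∈ P) (hS₁ : S₁ ⊆ P)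

/-- `ι_{n,k}` corestricted to `Sel^{ε,S₀}_R(K_∞, A)`. [cite: Kobayashi2003, Def. 1.1] -/
def iotaSat (n k : ℕ) : ↥(layerShaRestricted P (torsRep M hstab p k) (κ.layerSubgroup n) 1) →+ ↥(signedTransportSelmerInftySat κ M R V j S₀ ε) :=
  (iotaO κ P M hstab n k).codRestrict _ fun z ↦ iotaO_mem_signedTransportSelmerInftySat κ P M hstab R V j S₀ ε hpP n k z

/-- Values of `iotaSat`. [folklore] -/
theorem coe_iotaSat (n k : ℕ) (z : ↥(layerShaRestricted P (torsRep M hstab p k) (κ.layerSubgroup n) 1)) :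
    ((iotaSat κ P M hstab R V j S₀ ε hpP n k z : ↥(signedTransportSelmerInftySat κ M R V j S₀ ε)) : subgroupH1 κ.kerSubgroup M) = iotaO κ P M hstab n k z := rfl

/-- ★ **`ι_{n,k} : Ш¹_P(K_n, A[p^k]) →+ Sel_{str at Σ}(K_∞, A)`** for `Σ ⊆ P` (lambda-p1's `strictSelmer`): every conjugate of `ι z` is killed by `loc_w`, `w ∈ Σ` (`iotaO_conjYO` +
`locAt_iotaO_eq_zero`). The comparison maps of the Poitou–Tate socket for `U := strictSelmer …`. [cite: Kobayashi2003, Thm. 7.3 i)] [cite: JohnsonLeungKings2011, §5.4 Lemma 5.8] -/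
def iotaSel (n k : ℕ) : ↥(layerShaRestricted P (torsRep M hstab p k) (κ.layerSubgroup n) 1) →+ ↥(strictSelmer κ M R V j S₀ ε S₁) :=
  (iotaSat κ P M hstab R V j S₀ ε hpP n k).codRestrict _ fun z ↦ (mem_strictSelmer_iff κ M R V j S₀ ε S₁ _).2 fun w hw σ ↦ by
    rw [coe_iotaSat, ← iotaO_conjYO]
    exact locAt_iotaO_eq_zero κ P M hstab (hS₁ hw) n k _

/-- Values of `iotaSel`. [folklore] -/
theorem coe_coe_iotaSel (n k : ℕ) (z : ↥(layerShaRestricted P (torsRep M hstab p k) (κ.layerSubgroup n) 1)) :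
    (((iotaSel κ P M hstab R V j S₀ ε S₁ hpP hS₁ n k z : ↥(strictSelmer κ M R V j S₀ ε S₁)) : ↥(signedTransportSelmerInftySat κ M R V j S₀ ε)) :
        subgroupH1 κ.kerSubgroup M) = iotaO κ P M hstab n k z := rfl

/-- `ι^{Sel} z = 0 ↔ ι z = 0` (for the kernel property). [folklore] -/
theorem iotaSel_eq_zero_iff (n k : ℕ) (z : ↥(layerShaRestricted P (torsRep M hstab p k) (κ.layerSubgroup n) 1)) :
    iotaSel κ P M hstab R V j S₀ ε S₁ hpP hS₁ n k z = 0 ↔ iotaO κ P M hstab n k z = 0 := by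
  rw [← coe_coe_iotaSel κ P M hstab R V j S₀ ε S₁ hpP hS₁ n k z]
  exact ⟨fun h ↦ by rw [h]; rfl, fun h ↦ Subtype.ext (Subtype.ext h)⟩

variable (hNP : ∀ n : ℕ, ramificationSubgroup K P ≤ κ.layerSubgroup n) (hA : ∀ k : ℕ, ramificationSubgroup K P ≤ ContinuousRep.ker (torsRep M hstab p k))

/-- **Law (res)** for `iotaSel`. [cite: SerreGaloisCohomology1997, I §2.5] -/
theorem iotaSel_resYO (n k : ℕ) (z : ↥(layerShaRestricted P (torsRep M hstab p k) (κ.layerSubgroup n) 1)) :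
    iotaSel κ P M hstab R V j S₀ ε S₁ hpP hS₁ (n + 1) k (resYO κ P M hstab hNP hA n k z) = iotaSel κ P M hstab R V j S₀ ε S₁ hpP hS₁ n k z :=
  Subtype.ext (Subtype.ext (iotaO_resYO κ P M hstab hNP hA n k z))

/-- **Law (incl)** for `iotaSel`. [cite: SerreGaloisCohomology1997, I §2.4] -/
theorem iotaSel_inclYO (n k : ℕ) (z : ↥(layerShaRestricted P (torsRep M hstab p k) (κ.layerSubgroup n) 1)) :
    iotaSel κ P M hstab R V j S₀ ε S₁ hpP hS₁ n (k + 1) (inclYO κ P M hstab hNP hA n k z) = iotaSel κ P M hstab R V j S₀ ε S₁ hpP hS₁ n k z :=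
  Subtype.ext (Subtype.ext (iotaO_inclYO κ P M hstab hNP hA n k z))

/-- **Law (conj)** for `iotaSel`: `ι (conj_δ z) = conjStrict δ (ι z)` (lambda-p1's `conjStrict`). [cite: SerreLocalFields1979, VII §5 Prop. 3] [cite: GreenbergVatsal2000, §2 p. 17] -/
theorem iotaSel_conjYO (n k : ℕ) (δ : absoluteGaloisGroup K) (z : ↥(layerShaRestricted P (torsRep M hstab p k) (κ.layerSubgroup n) 1)) :
    iotaSel κ P M hstab R V j S₀ ε S₁ hpP hS₁ n k (conjYO κ P M hstab n k δ z) =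
      conjStrict κ M R V j S₀ ε S₁ δ (iotaSel κ P M hstab R V j S₀ ε S₁ hpP hS₁ n k z) := by
  apply Subtype.ext; apply Subtype.ext
  change iotaO κ P M hstab n k (conjYO κ P M hstab n k δ z) = conjH1 κ.kerSubgroup M δ (iotaO κ P M hstab n k z)
  exact iotaO_conjYO κ P M hstab n k δ z

end Sel

end Summit.BirchSwinnertonDyer.BirchSwinnertonDyer.Theorems.SmallImageRttJunctionSha

end
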